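import Summits.Ventures.HSemireg.WedgeHankelDivisorTopRank
import Summits.Ventures.HSemireg.WedgeHankelDivisorGeneric
import Summits.Ventures.HSemireg.WedgeHankelDivisorImage

/-!
# Venture HSemireg — THE `P¹` DIVISOR LAW, FULL-ROW-RANK REGIME AND IMAGES: `rank H_k = min(D, k + 1)` for a divisor on `P¹` of total order `D ≤ n + 1 − k`, the generic
# kernel `SI_k` for `D ≥ k + 1`, and the image as the DIRECT SUM of the node images (finite nodes and `∞`)

HONEST FRAMING. Part of the Lean index of the computation cell `pub-hsemireg` (seat p10 gen 16, Sunday typer «UNIFORM-IN-n»).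
Finite-dimensional EXTERIOR ALGEBRA + Hankel matrices over a field ONLY: no variety, no cohomology theory, no sheaf, no Ext group, no semiregularity map;
nothing here says that HC / HC_CM / HC_AV holds; no Literature fact is declared or used.  Custodian versions as in `WedgeHankelSiegelIdeal` (1/3) and
`WedgeHankelFrameChange`; the dictionary (divisor on `P¹`, `rev_n q∞` = node at `∞`) is QUOTED, never asserted.

WHAT IS IN THE TREE / KEYED.  F3a (`P¹` factorization `H = cvMatTᵀ · hkMatT · cvMatT`, `cvMatT` onto, rank `= D` for `D ≤ min(k+1, n+1−k)`), F2c (`cvMat c` injective for `c ≤ D_fin`, by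
column truncation), F2d (images of finite divisors add directly).  THIS FILE:
* §70 **`cvMatT_mulVecLin_injective`**: `cvMatT (k+1)` is injective when `k + 1 ≤ D` — a vector killed by the `∞`-rows has its top `P∞ + 1` entries zero, and its truncation
  is killed by `cvMat (k − P∞)`, injective by F2c since `k − P∞ ≤ D_fin`; hence **`rank_hankel1_expMul_sum_add_rev_of_le`: rank `= k + 1` for `k + 1 ≤ D ≤ n + 1 − k`**,
  **`rank_hankel1_expMul_sum_add_rev_eq_min`: `rank H_k = min(D, k+1)` for `D ≤ n + 1 − k`**, and **`Kr_w_expMul_sum_add_rev_eq_siegelIdeal`: `Kr = SI_k`** there.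
* §71 **THE `P¹` DIVISOR IMAGE LAW `V_w_expMul_sum_add_rev`**: for `D ≤ min(k+1, n+1−k)` the image `V(univ, w_n(Σ_i expMul λ_i q_i + rev_n q∞), k)` is the sum of the node
  images `(⨆_i V_i) ⊔ V_∞`, of dimension `D·C(n,k)`, and (`Option`-indexed) the sum is DIRECT (`iSupIndep_V_w_expMul_option`).
NOT typed here: degrees with `D > n + 1 − k`.  Class side only.  Namespace `Summit.Ventures.HSemireg.Wedge.HankelFrameChange` (continued); new names only.
-/

open Module
open scoped Matrix

namespace Summit.Ventures.HSemireg.Wedge.HankelFrameChange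

open Summit.Ventures.HSemireg.Wedge Summit.Ventures.HSemireg.Wedge.Kunneth Summit.Ventures.HSemireg.Wedge.Hankel
  Summit.Ventures.HSemireg.Wedge.HankelSiegel Summit.Ventures.HSemireg.Wedge.HankelSiegelIdeal Summit.Ventures.HSemireg.Wedge.KunnethKernel
  Summit.Ventures.HSemireg.Wedge.HankelSecant

variable (K : Type*) [Field K] {n : ℕ}

/-! ## §70. The full-row-rank regime on `P¹` -/

/-- **`cvMatT (k+1)` IS INJECTIVE for `k + 1 ≤ Σ_i (P_i+1) + (P∞+1)`**: the `∞`-rows kill the top `P∞ + 1` coordinates, and the truncation to `K^{k−P∞}` is killed by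
`cvMat (k − P∞)`, injective by F2c. -/
theorem cvMatT_mulVecLin_injective {r : ℕ} {lam : Fin r → K} (hlam : Function.Injective lam) (P : Fin r → ℕ) (Pinf : ℕ) {k : ℕ}
    (hkD : k + 1 ≤ ∑ i, (P i + 1) + (Pinf + 1)) : Function.Injective (cvMatT K lam P Pinf (k + 1)).mulVecLin := by
  rw [← LinearMap.ker_eq_bot, LinearMap.ker_eq_bot']
  intro v hv
  rw [Matrix.mulVecLin_apply, cvMatT, Matrix.fromRows_mulVec] at hv
  have hfin : cvMat K lam P (k + 1) *ᵥ v = 0 := by funext x; have := congrFun hv (Sum.inl x); simpa using this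
  have htop : topMat K Pinf (k + 1) *ᵥ v = 0 := by funext t; have := congrFun hv (Sum.inr t); simpa using this
  -- the top P∞+1 coordinates vanish
  have hvtop : ∀ l : Fin (k + 1), k ≤ (l : ℕ) + Pinf → v l = 0 := by
    intro l hl
    have hl2 := l.2
    have ht : k - (l : ℕ) < Pinf + 1 := by omega
    have h := congrFun htop ⟨k - (l : ℕ), ht⟩
    rw [Pi.zero_apply, Matrix.mulVec, dotProduct, Finset.sum_eq_single l] at h
    · rwa [topMat_apply, if_pos (by simp; omega), one_mul] at h
    · intro l' _ hl'
      rw [topMat_apply, if_neg (fun e => hl' (Fin.ext (by simp at e; omega))), zero_mul]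
    · intro hh; exact absurd (Finset.mem_univ _) hh
  -- truncate to the first k − P∞ coordinates (if P∞ ≥ k + 1 everything already vanishes)
  by_cases hkP : Pinf + 1 ≤ k + 1
  · set c := k - Pinf with hc
    have hck : c ≤ k + 1 := by omega
    set v' : Fin c → K := fun l => v (Fin.castLE hck l) with hv'
    have hz' : cvMat K lam P c *ᵥ v' = 0 := by
      funext x
      have hx := congrFun hfin x
      rw [Pi.zero_apply, Matrix.mulVec, dotProduct] at hx ⊢
      rw [← hx]
      have hsub : (Finset.univ.map (Fin.castLEEmb hck) : Finset (Fin (k + 1))) ⊆ Finset.univ := Finset.subset_univ _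
      rw [← Finset.sum_subset hsub, Finset.sum_map]
      · refine Finset.sum_congr rfl fun l _ => ?_
        rw [Fin.castLEEmb_apply, ← cvMat_castLE K lam P hck]
      · intro l _ hl
        have hlc : ¬ (l : ℕ) < c := fun hlt => hl (Finset.mem_map.mpr ⟨⟨l, hlt⟩, Finset.mem_univ _, Fin.ext rfl⟩)
        rw [hvtop l (by omega), mul_zero]
    have hzv' : v' = 0 := cvMat_mulVecLin_injective K hlam P (c := c) (by omega) (by rw [Matrix.mulVecLin_apply, hz', map_zero])
    funext l
    by_cases hl : (l : ℕ) < c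
    · have := congrFun hzv' ⟨l, hl⟩
      simpa only [hv', Fin.castLE_mk, Fin.eta, Pi.zero_apply] using this
    · exact hvtop l (by omega)
  · funext l; exact hvtop l (by omega)

/-- `hkMatT` is onto for exact orders (square + injective, F3a). -/
theorem range_hkMatT_mulVecLin_eq_top {r : ℕ} (P : Fin r → ℕ) {q : Fin r → ℕ → K} (hq : ∀ i j, P i < j → q i j = 0) (hqP : ∀ i, q i (P i) ≠ 0)
    (Pinf : ℕ) {qinf : ℕ → K} (hqi : ∀ j, Pinf < j → qinf j = 0) (hqiP : qinf Pinf ≠ 0) :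
    LinearMap.range (hkMatT K P q Pinf qinf).mulVecLin = ⊤ :=
  LinearMap.range_eq_top.mpr (LinearMap.injective_iff_surjective.mp (hkMatT_mulVecLin_injective K P hq hqP Pinf hqi hqiP))

/-- **`rank H_k(Σ_i expMul λ_i q_i + rev_n q∞) = k + 1` for `k + 1 ≤ D ≤ n + 1 − k`** (`D = Σ_i (P_i+1) + (P∞+1)`; distinct finite nodes, exact orders). -/
theorem rank_hankel1_expMul_sum_add_rev_of_le {k r : ℕ} {lam : Fin r → K} (hlam : Function.Injective lam) {P : Fin r → ℕ} {q : Fin r → ℕ → K}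
    (hq : ∀ i j, P i < j → q i j = 0) (hqP : ∀ i, q i (P i) ≠ 0) {Pinf : ℕ} {qinf : ℕ → K} (hqi : ∀ j, Pinf < j → qinf j = 0) (hqiP : qinf Pinf ≠ 0)
    (hkD : k + 1 ≤ ∑ i, (P i + 1) + (Pinf + 1)) (hDn : ∑ i, (P i + 1) + (Pinf + 1) ≤ n + 1 - k) :
    (hankel1 K n k (fun j => (∑ i, expMul K (lam i) (q i) j) + rev K n qinf j)).rank = k + 1 := by
  rw [hankel1_expMul_sum_add_rev K n k (by omega) lam hq hqi, Matrix.rank, Matrix.mulVecLin_mul,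
    LinearMap.range_comp_of_range_eq_top _ (range_cvMatT_mulVecLin_eq_top K hlam P Pinf hDn), Matrix.mulVecLin_mul,
    LinearMap.range_comp_of_range_eq_top _ (range_hkMatT_mulVecLin_eq_top K P hq hqP Pinf hqi hqiP), ← Matrix.rank, Matrix.rank_transpose, Matrix.rank,
    LinearMap.finrank_range_of_inj (cvMatT_mulVecLin_injective K hlam P Pinf hkD), finrank_fintype_fun_eq_card, Fintype.card_fin]

/-- **THE `P¹` DIVISOR RANK LAW, BOTH REGIMES: `rank H_k = min(D, k + 1)` whenever `D ≤ n + 1 − k`.** -/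
theorem rank_hankel1_expMul_sum_add_rev_eq_min {k r : ℕ} {lam : Fin r → K} (hlam : Function.Injective lam) {P : Fin r → ℕ} {q : Fin r → ℕ → K}
    (hq : ∀ i j, P i < j → q i j = 0) (hqP : ∀ i, q i (P i) ≠ 0) {Pinf : ℕ} {qinf : ℕ → K} (hqi : ∀ j, Pinf < j → qinf j = 0) (hqiP : qinf Pinf ≠ 0)
    (hDn : ∑ i, (P i + 1) + (Pinf + 1) ≤ n + 1 - k) :
    (hankel1 K n k (fun j => (∑ i, expMul K (lam i) (q i) j) + rev K n qinf j)).rank = min (∑ i, (P i + 1) + (Pinf + 1)) (k + 1) := by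
  rcases le_total (∑ i, (P i + 1) + (Pinf + 1)) (k + 1) with h | h
  · rw [min_eq_left h]; exact rank_hankel1_expMul_sum_add_rev K hlam hq hqP hqi hqiP h hDn
  · rw [min_eq_right h]; exact rank_hankel1_expMul_sum_add_rev_of_le K hlam hq hqP hqi hqiP h hDn

/-- **THE GENERIC KERNEL ON `P¹`: `Kr = SI_k` for `k + 1 ≤ D ≤ n + 1 − k`.** -/
theorem Kr_w_expMul_sum_add_rev_eq_siegelIdeal {k r : ℕ} {lam : Fin r → K} (hlam : Function.Injective lam) {P : Fin r → ℕ} {q : Fin r → ℕ → K}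
    (hq : ∀ i j, P i < j → q i j = 0) (hqP : ∀ i, q i (P i) ≠ 0) {Pinf : ℕ} {qinf : ℕ → K} (hqi : ∀ j, Pinf < j → qinf j = 0) (hqiP : qinf Pinf ≠ 0)
    (hkD : k + 1 ≤ ∑ i, (P i + 1) + (Pinf + 1)) (hDn : ∑ i, (P i + 1) + (Pinf + 1) ≤ n + 1 - k) :
    Kr K Finset.univ (w K n n (fun j => (∑ i, expMul K (lam i) (q i) j) + rev K n qinf j)) k = siegelIdeal K n k := by
  refine (Submodule.eq_of_le_of_finrank_eq (siegelIdeal_le_Kr_w K n k _) ?_).symm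
  have h1 := finrank_Kr_w_add_rank K (n := n) k (fun j => (∑ i, expMul K (lam i) (q i) j) + rev K n qinf j)
  rw [rank_hankel1_expMul_sum_add_rev_of_le K hlam hq hqP hqi hqiP hkD hDn] at h1
  have h2 := finrank_siegelIdeal K (n := n) k
  have : n.choose k * (k + 1) = (k + 1) * n.choose k := Nat.mul_comm _ _
  omega

/-! ## §71. The `P¹` divisor image law -/

/-- the image of the node at `∞` has dimension `(P∞ + 1)·C(n,k)` (exact order `P∞ ≤ k`, `k + P∞ ≤ n`; E7's swap + E6). -/
theorem finrank_V_w_rev_of_order {k Pinf : ℕ} (hPk : Pinf ≤ k) (hkP : k + Pinf ≤ n) {qinf : ℕ → K} (hq : ∀ j, Pinf < j → qinf j = 0) (hqP : qinf Pinf ≠ 0) :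
    finrank K (V K (In n) Finset.univ (w K n n (rev K n qinf)) k) = (Pinf + 1) * n.choose k := by
  rw [V_w_rev, (Ψs K (n := n)).toLinearEquiv.finrank_map_eq, finrank_V_w, rank_hankel1_of_order K hkP hq hqP, min_eq_left hPk, Nat.mul_comm]

/-- **THE `P¹` DIVISOR IMAGE LAW**: for `D = Σ_i (P_i+1) + (P∞+1) ≤ k + 1`, `≤ n + 1 − k` (distinct finite nodes, exact orders):
**`V(univ, w_n(Σ_i expMul λ_i q_i + rev_n q∞), k) = (⨆_i V(univ, w_n(expMul λ_i q_i), k)) ⊔ V(univ, w_n(rev_n q∞), k)`**, of dimension `D·C(n,k)`. -/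
theorem V_w_expMul_sum_add_rev {k r : ℕ} {lam : Fin r → K} (hlam : Function.Injective lam) {P : Fin r → ℕ} {q : Fin r → ℕ → K}
    (hq : ∀ i j, P i < j → q i j = 0) (hqP : ∀ i, q i (P i) ≠ 0) {Pinf : ℕ} {qinf : ℕ → K} (hqi : ∀ j, Pinf < j → qinf j = 0) (hqiP : qinf Pinf ≠ 0)
    (hDk : ∑ i, (P i + 1) + (Pinf + 1) ≤ k + 1) (hDn : ∑ i, (P i + 1) + (Pinf + 1) ≤ n + 1 - k) :
    V K (In n) Finset.univ (w K n n (fun j => (∑ i, expMul K (lam i) (q i) j) + rev K n qinf j)) k =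
        (⨆ i, V K (In n) Finset.univ (w K n n (expMul K (lam i) (q i))) k) ⊔ V K (In n) Finset.univ (w K n n (rev K n qinf)) k ∧
      finrank K ↥((⨆ i, V K (In n) Finset.univ (w K n n (expMul K (lam i) (q i))) k) ⊔ V K (In n) Finset.univ (w K n n (rev K n qinf)) k) =
        (∑ i, (P i + 1) + (Pinf + 1)) * n.choose k := by
  have hPi : ∀ i, P i + 1 ≤ ∑ j, (P j + 1) := fun i => Finset.single_le_sum (fun j _ => Nat.zero_le (P j + 1)) (Finset.mem_univ i)
  have hV : finrank K (V K (In n) Finset.univ (w K n n (fun j => (∑ i, expMul K (lam i) (q i) j) + rev K n qinf j)) k) =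
      (∑ i, (P i + 1) + (Pinf + 1)) * n.choose k := by
    rw [finrank_V_w, rank_hankel1_expMul_sum_add_rev K hlam hq hqP hqi hqiP hDk hDn, Nat.mul_comm]
  have hVi : ∀ i, finrank K (V K (In n) Finset.univ (w K n n (expMul K (lam i) (q i))) k) = (P i + 1) * n.choose k := fun i =>
    finrank_V_w_expMul_of_order K (lam i) (by have := hPi i; omega) (by have := hPi i; omega) (hq i) (hqP i)
  have hVinf := finrank_V_w_rev_of_order K (n := n) (k := k) (Pinf := Pinf) (by omega) (by omega) hqi hqiP
  -- the class is the sum; its image lies in the sum of the images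
  have hle : V K (In n) Finset.univ (w K n n (fun j => (∑ i, expMul K (lam i) (q i) j) + rev K n qinf j)) k ≤
      (⨆ i, V K (In n) Finset.univ (w K n n (expMul K (lam i) (q i))) k) ⊔ V K (In n) Finset.univ (w K n n (rev K n qinf)) k := by
    rw [V_eq_map, Submodule.map_le_iff_le_comap]
    intro θ hθ
    rw [Submodule.mem_comap, LinearMap.mulRight_apply, w_add, mul_add]
    refine Submodule.add_mem _ (Submodule.mem_sup_left ?_) (Submodule.mem_sup_right ?_)
    · have h := V_w_sum_le_iSup K (n := n) (fun i => expMul K (lam i) (q i)) k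
      rw [V_eq_map] at h
      exact h ⟨θ, hθ, rfl⟩
    · rw [V_eq_map]; exact ⟨θ, hθ, rfl⟩
  -- dimension of the sum ≤ sum of dimensions
  have hsup : finrank K ↥((⨆ i, V K (In n) Finset.univ (w K n n (expMul K (lam i) (q i))) k) ⊔ V K (In n) Finset.univ (w K n n (rev K n qinf)) k) ≤
      (∑ i, (P i + 1) + (Pinf + 1)) * n.choose k := by
    refine (Submodule.finrank_add_le_finrank_add_finrank _ _).trans ?_
    rw [add_mul, hVinf]
    refine Nat.add_le_add_right ?_ _
    by_cases hr : r = 0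
    · subst hr; simp
    · have hr' : 0 < r := Nat.pos_of_ne_zero hr
      have hq0 : ∀ i, q i (P i) ≠ 0 := hqP
      -- F2d's count for the finite part (needs the finite total order within range)
      rw [(V_w_expMul_sum K hlam hq hq0 (by omega) (by omega)).2]
  have hge : (∑ i, (P i + 1) + (Pinf + 1)) * n.choose k ≤
      finrank K ↥((⨆ i, V K (In n) Finset.univ (w K n n (expMul K (lam i) (q i))) k) ⊔ V K (In n) Finset.univ (w K n n (rev K n qinf)) k) := by
    rw [← hV]; exact Submodule.finrank_mono hle
  exact ⟨Submodule.eq_of_le_of_finrank_le hle (by omega), le_antisymm hsup hge⟩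

/-- **THE NODE AT `∞` IS INDEPENDENT OF THE FINITE NODES**: `(⨆_i V_i) ⊓ V_∞ = ⊥` in the range of the `P¹` image law. -/
theorem iSup_V_w_expMul_disjoint_rev {k r : ℕ} {lam : Fin r → K} (hlam : Function.Injective lam) {P : Fin r → ℕ} {q : Fin r → ℕ → K}
    (hq : ∀ i j, P i < j → q i j = 0) (hqP : ∀ i, q i (P i) ≠ 0) {Pinf : ℕ} {qinf : ℕ → K} (hqi : ∀ j, Pinf < j → qinf j = 0) (hqiP : qinf Pinf ≠ 0)
    (hDk : ∑ i, (P i + 1) + (Pinf + 1) ≤ k + 1) (hDn : ∑ i, (P i + 1) + (Pinf + 1) ≤ n + 1 - k) :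
    Disjoint (⨆ i, V K (In n) Finset.univ (w K n n (expMul K (lam i) (q i))) k) (V K (In n) Finset.univ (w K n n (rev K n qinf)) k) := by
  have hPi : ∀ i, P i + 1 ≤ ∑ j, (P j + 1) := fun i => Finset.single_le_sum (fun j _ => Nat.zero_le (P j + 1)) (Finset.mem_univ i)
  have htot := (V_w_expMul_sum_add_rev K hlam hq hqP hqi hqiP hDk hDn).2
  have hVinf := finrank_V_w_rev_of_order K (n := n) (k := k) (Pinf := Pinf) (by omega) (by omega) hqi hqiP
  have hfin : finrank K ↥(⨆ i, V K (In n) Finset.univ (w K n n (expMul K (lam i) (q i))) k) ≤ (∑ i, (P i + 1)) * n.choose k := by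
    by_cases hr : r = 0
    · subst hr; simp
    · rw [(V_w_expMul_sum K hlam hq hqP (by omega) (by omega)).2]
  have hdim := Submodule.finrank_sup_add_finrank_inf_eq (⨆ i, V K (In n) Finset.univ (w K n n (expMul K (lam i) (q i))) k)
    (V K (In n) Finset.univ (w K n n (rev K n qinf)) k)
  rw [htot, hVinf, add_mul] at hdim
  have h0 : finrank K ↥((⨆ i, V K (In n) Finset.univ (w K n n (expMul K (lam i) (q i))) k) ⊓ V K (In n) Finset.univ (w K n n (rev K n qinf)) k) = 0 := by
    omega
  rw [disjoint_iff, Submodule.finrank_eq_zero.mp h0]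

end Summit.Ventures.HSemireg.Wedge.HankelFrameChange
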